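import Summits.AtomisticToContinuum.BoseEinsteinCondensation.Theorems.BECThomsonPrincipleGaussianDominationCanFreeAnchorOf
import Summits.AtomisticToContinuum.BoseEinsteinCondensation.Theorems.BECThomsonPrincipleGaussianDominationCanModeBessel
import Summits.AtomisticToContinuum.BoseEinsteinCondensation.Theorems.BECThomsonPrincipleGaussianDominationCanThetaNorm
import Summits.AtomisticToContinuum.BoseEinsteinCondensation.Theorems.BECThomsonPrincipleGaussianDominationCanChordTransport
import HarnessLib

/-!
# `GaussianDominationCan` for BOUNDED potentials from the single sign `SourceRaisesInteraction`

Route `BECThomsonPrinciple`, crux `GaussianDominationCan` (stmt-AtomisticToContinuum-9479), line `coupling-monotone-chord`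
(lead), registered stub `stub_boundedCase`.  Supports (does not close) the item.

With the free anchor (A1–A3) and the chord transport (C) landed, the crux restricted to BOUNDED admissible potentials
(`∃ B, v ≤ B`) follows from the open sign ALONE, and in a WEAK per-potential form (threshold `ρ₀(M, w)`, sign only along the ray `τ • w`,
`τ ∈ (0,1]`; implied by stub B `SourceRaisesInteraction`, `raySign_of_sourceRaisesInteraction`) — with the SHARP constant `C = 1/(4π²)`, `N₀ = 0` and the density
threshold `ρ₀ = ρ₀_B(M, R₀)`: for each window datum, B supplies the sign along the ray `τ • v`, `τ ∈ (0, 1]` (each `τ • v` is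
bounded, measurable, of range `R₀`), and C transports the free chord to `v`.  No truncation (hence no `MaxFormBound`) is
needed in the bounded case.  So for bounded potentials the whole open content of the crux is the sign B. [folklore]
-/

noncomputable section

namespace Summit.AtomisticToContinuum.BoseEinsteinCondensation.Cruxes.GaussianDominationCan.CouplingMonotoneChord

open scoped ENNReal
open Literature.MathematicalPhysics.QuantumManyBody.BoseGas
open Summit.AtomisticToContinuum.BoseEinsteinCondensation.Theorems.GaussianDominationCan.Negative (GDIneq InWindow GDCanWith)

/-- **Registered stub `stub_boundedCase`: the crux for bounded potentials from the sign along ONE ray.**  If for every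
window parameter `M` and every bounded admissible `w` there is a density threshold `ρ₀ = ρ₀(M, w) > 0` below which the
source raises the ground-state interaction energy at every point `τ • w`, `τ ∈ (0, 1]`, of ITS OWN coupling ray (a WEAK,
per-potential form of stub B `SourceRaisesInteraction`, which asks `ρ₀ = ρ₀(M, R₀)` uniformly in the coupling strength —
see `raySign_of_sourceRaisesInteraction`), then for every bounded admissible `v` and every `M > 0`:
`GDCanWith ρ₀ (1/(4π²)) 0 v M` (sharp constant, `N₀ = 0`). [folklore] -/
theorem stub_boundedCase :
    (∀ M : ℝ, 0 < M → ∀ w : ℝ → ℝ≥0∞, IsRepulsiveFiniteRange w → (∃ B : ℝ, ∀ r, w r ≤ ENNReal.ofReal B) →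
      ∃ ρ₀ : ℝ, 0 < ρ₀ ∧ ∀ m : ℕ, ∀ L : ℝ, 0 < L → ((m + 1 : ℕ) : ℝ) ≤ ρ₀ * L ^ 3 →
        ∀ n : Fin 3 → ℤ, n ≠ 0 → InWindow M m L n →
          ∀ τ : ℝ, 0 < τ → τ ≤ 1 → SourceRaisesInteractionAt (scalePot τ w) m L n) →
    ∀ v : ℝ → ℝ≥0∞, IsRepulsiveFiniteRange v → (∃ B : ℝ, ∀ r, v r ≤ ENNReal.ofReal B) → ∀ M : ℝ, 0 < M →
      ∃ ρ₀ : ℝ, 0 < ρ₀ ∧ GDCanWith ρ₀ (1 / (4 * Real.pi ^ 2)) 0 v M := by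
  intro hBw v hv hbound M hM
  obtain ⟨ρ₀, hρ₀, hray⟩ := hBw M hM v hv hbound
  refine ⟨ρ₀, hρ₀, ?_⟩
  intro m _ L hL hdens n hn hwin
  change GDChordBody v (1 / (4 * Real.pi ^ 2)) m L n
  exact stub_chordTransport v hv hbound m L hL n hn
    (fun τ hτ hτ1 => hray m L hL hdens n hn hwin τ hτ hτ1) _ (by positivity)
    (stub_freeAnchorOf stub_modeBessel stub_thetaNorm m L hL n hn)

/-- Stub B (`SourceRaisesInteraction`, threshold uniform in the coupling strength) implies the per-ray hypothesis of
`stub_boundedCase` (each `τ • w`, `τ ∈ (0,1]`, is bounded by `τB`, measurable, of the same range). [folklore] -/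
theorem raySign_of_sourceRaisesInteraction (hB : SourceRaisesInteraction) :
    (∀ M : ℝ, 0 < M → ∀ w : ℝ → ℝ≥0∞, IsRepulsiveFiniteRange w → (∃ B : ℝ, ∀ r, w r ≤ ENNReal.ofReal B) →
    ∃ ρ₀ : ℝ, 0 < ρ₀ ∧ ∀ m : ℕ, ∀ L : ℝ, 0 < L → ((m + 1 : ℕ) : ℝ) ≤ ρ₀ * L ^ 3 →
      ∀ n : Fin 3 → ℤ, n ≠ 0 → InWindow M m L n →
        ∀ τ : ℝ, 0 < τ → τ ≤ 1 → SourceRaisesInteractionAt (scalePot τ w) m L n) := by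
  intro M hM w hw hbound
  obtain ⟨hmeas, R₀, hR₀⟩ := hw
  obtain ⟨ρ₀, hρ₀, hSRI⟩ := hB M hM R₀
  refine ⟨ρ₀, hρ₀, fun m L hL hdens n hn hwin τ hτ _ => ?_⟩
  obtain ⟨B, hBv⟩ := hbound
  have hmeasτ : Measurable (scalePot τ w) := by
    unfold scalePot
    exact hmeas.const_mul _
  have hrangeτ : ∀ r, R₀ < r → scalePot τ w r = 0 := fun r hr => by
    show ENNReal.ofReal τ * w r = 0
    rw [hR₀ r hr, mul_zero]
  exact hSRI (scalePot τ w) hmeasτ hrangeτ ⟨τ * B, scalePot_le hτ.le hBv⟩ m L hL hdens n hn hwin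

/-- Corollary: stub B gives the crux in its own quantifier shape for every BOUNDED admissible potential (no truncation,
hence no `MaxFormBound`, is needed in the bounded case). [folklore] -/
theorem gdCan_bounded_of_sourceRaisesInteraction (hB : SourceRaisesInteraction) :
    ∀ v : ℝ → ℝ≥0∞, IsRepulsiveFiniteRange v → (∃ B : ℝ, ∀ r, v r ≤ ENNReal.ofReal B) → ∀ M : ℝ, 0 < M →
      ∃ ρ₀ C : ℝ, 0 < ρ₀ ∧ 0 < C ∧ ∃ N₀ : ℕ, GDCanWith ρ₀ C N₀ v M := fun v hv hb M hM => by
  obtain ⟨ρ₀, hρ₀, h⟩ := stub_boundedCase (raySign_of_sourceRaisesInteraction hB) v hv hb M hM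
  exact ⟨ρ₀, 1 / (4 * Real.pi ^ 2), hρ₀, by positivity, 0, h⟩

end Summit.AtomisticToContinuum.BoseEinsteinCondensation.Cruxes.GaussianDominationCan.CouplingMonotoneChord

end
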